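import Literature.Barriers.SmoothPoincare4.ExoticOpenFourSpace
import Mathlib.Topology.Instances.CantorSet
import Mathlib.SetTheory.Cardinal.Continuum
import Mathlib.SetTheory.Cardinal.Arithmetic
import Mathlib.Analysis.InnerProductSpace.Calculus
import HarnessLib

/-!
# `Literature.Barriers.SmoothPoincare4.deMichelisFreedman1992_continuum`: triage of the discharge; the ZFC step (Cor. 4.1) and the combination step of Thm. 4.1 proved

Proof file (sibling of `Literature.Barriers.SmoothPoincare4.ExoticOpenFourSpace`) for the named
fact `deMichelisFreedman1992_continuum` (continuum many pairwise non-diffeomorphic open subsets of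
standard `ℝ⁴`, each homeomorphic to `ℝ⁴`; DeMichelis–Freedman 1992, Thm. 4.1 with Cor. 4.1).
This file records the triage of its unconditional discharge (size XL: gauge theory on end-periodic
4-manifolds plus Freedman's topological theory, none of it in Mathlib or `Literature/`) and PROVES
the steps of the printed proof that are formalizable today, the LEAF of the discharge — the
family of Thm. 4.1 with its countable diffeomorphism classes — entering as an explicit
HYPOTHESIS, never as a named fact: Cor. 4.1, the passage in ZFC from "countable equivalence
classes on the standard Cantor set" to "continuum many pairwise nondiffeomorphic members"
(`deMichelisFreedman1992_continuum_of_countableClasses`, whose hypothesis IS the leaf); and the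
third paragraph of the printed proof of Thm. 4.1 (p. 247, "Combining the previous two
paragraphs") — the leaf follows from the gauge-theoretic no-go of its first paragraph (no
diffeomorphism `R⁴_s → R⁴_t`, `s ≠ t`, restricts to the identity on the compactum `K`) together
with the general fact of its second paragraph (a compact smooth manifold has only countably many
smooth embeddings into a metrizable smooth manifold up to isotopy, in the ambient form given by
the isotopy extension theorem), both again HYPOTHESES
(`deMichelisFreedman1992_countableClasses_of_core`, `deMichelisFreedman1992_continuum_of_core`;
the second is discharged in the sequel `ExoticOpenFourSpaceEmbeddingProofs.lean`).

## D-0026 review of the decomposition (2026-08-15): the leaf is merged back, not a named fact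

Revisions p20788–p52908 of this cone carried the leaf as a named fact
`deMichelisFreedman1992_countableClasses` — a decomposition child of
`deMichelisFreedman1992_continuum` — whose own prove seat could only triage it XL again. The
review MERGED it back into the parent's single proof obligation: the child is Thm. 4.1 and the
parent its Cor. 4.1, so the child carried the parent's entire mathematical content (steps 1–5
below: Kotschick's `Φ`-invariant, Taubes' end-periodic theory, Casson handles and Freedman's
reimbedding theorems) minus a ZFC triviality — not an M-sized distinct result but the parent
restated one corollary upstream; and decompositions do not recurse. The `def` is deleted and its
statement is spelled out, verbatim, wherever it stood: as the hypothesis `h` of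
`deMichelisFreedman1992_cor41_of_countableClasses`,
`deMichelisFreedman1992_continuum_of_countableClasses`,
`openAnalogueBarrierFour_of_countableClasses`, and as the conclusion of
`deMichelisFreedman1992_countableClasses_of_core` (likewise in the sequels
`ExoticOpenFourSpaceEmbeddingProofs.lean`, `ExoticOpenFourSpacePolarProofs.lean`); names, proofs
and every other declaration are unchanged. The only named fact of this cone is
`deMichelisFreedman1992_continuum` (`ExoticOpenFourSpace.lean`).

## The printed statements (S. DeMichelis, M. H. Freedman, *Uncountably many exotic `R⁴`'s in
standard 4-space*, J. Differential Geom. 35 (1992) 219–254)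

* §4, p. 246: "Any open subset of a Euclidean space acquires a natural smooth structure by
  restriction. By a topological radial function we mean a homeomorphism followed by the usual
  radius function `R⁴_std → [0, ∞)`."
* Thm. 4.1 (p. 246): "There is a subset `R⁴_1` of Euclidean 4-space `R⁴_std` which is
  homeomorphic but not diffeomorphic to `R⁴_std`. Moreover, `R⁴_1` has a topological system of
  polar coordinates with radial function `ρ` so that the open balls of radius `r` are 'ribbon
  4-spaces' `R⁴_t` in the sense of §3 whenever `t = 1 - 1/r` belongs to the standard Cantor set
  `CS ⊂ [0, 1]`. We say `t` and `t'` are equivalent if `R⁴_t` and `R⁴_{t'}` are diffeomorphic. The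
  resulting equivalence classes are at most countable. Also, `ρ` restricted to `[0, r]` for any
  `r` extends to a topological polar coordinate on all of `R⁴_std`."
* Cor. 4.1 (p. 247): "In Zermelo-Frankel set theory with choice (ZFC) we may assert that there is
  a collection of parameter values `{t'} ⊂ CS ⊂ [0, 1]` with `card({t'}) =` 'continuum' `= 𝔠`
  such that the subsets `R⁴_{t'}` are pairwise nondiffeomorphic."
* Proof of Cor. 4.1 (p. 248): "In the presence of choice, we may well-order the set of equivalence
  classes … a partition of [the classes] into a disjoint union of sets of cardinality `ℵ₀` … The
  standard diagonal argument shows that the cardinality of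
  `T_i = {t ∈ CS | equivalence class of R⁴_t lies in 𝒥_i}` is `ℵ₀` for each `i`. … Taking the
  union over `i` we have a bijection [between `CS` and the set of classes]."

## The printed proof of Thm. 4.1 (architecture, §0 and §4; why the leaf is XL)

1. (§1, Kotschick) The Barlow surface `B` and `Q = CP² # 8CP̄²` are smoothly h-cobordant, and
   Kotschick's `Φ`-invariant (signed count of a `0`-dimensional `SO(3)` ASD moduli space with
   `w₂ = (1,…,1)`, `p₁ = -3`) has `Φ(Q) = 0` while `Φ(B) ≠ 0`, "so `B` and `Q` are not
   diffeomorphic" (p. 222).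
2. (Thm. 3.1, p. 234) A simply connected smooth h-cobordism `(W; B, Q)` decomposes as `W = J ∪ U`
   with `J₀ × I ≅ J`, `U` a proper h-cobordism between `V₀ ⊂ B`, `V₁ ⊂ Q` "homeomorphic but not
   diffeomorphic to `R⁴`" which "inherit their smooth structure as open subsets of `R⁴_std`" (6),
   and a reimbedding `end V₀ ↪ end V₀` that "can be chosen to be an involution" (5) — Casson
   handles, Freedman's reimbedding and h-cobordism structure theorems.
3. (Thm. 3.2, p. 244) A ribbon 4-space with a compactum `K` carries a topological radius function
   `ρ` with `K ⊂ R⁴_0` and `R⁴_t = ρ⁻¹([0, r))` again ribbon for `t = 1 - 1/r ∈ CS`.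
4. (Thm. 2.1, p. 224, with Appendices A, B) `Φ` commutes with the end-periodic geometric limit
   `M_n → M_∞` (Taubes' weighted-Sobolev Fredholm theory for the ASD deformation complex).
5. (§4, p. 247) A diffeomorphism `(R⁴_s, K) → (R⁴_t, K)` restricting to the identity on `K`
   (`s ≠ t ∈ CS`) would make the end-periodic `B_∞` and `Q_∞` isometric, whence
   `Φ(B) = Φ(B_∞) = Φ(Q_∞) = Φ(Q)`, a contradiction; and "a smooth compact manifold admits only
   countably many smooth embeddings, up to isotopy, into any smooth metrizable manifold", so "the
   subsets `R⁴_t` could be mutually diffeomorphic for at most countably many parameter values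
   `t ∈ CS`."

Steps 1–4 are not statable with present Mathlib/`Literature/` infrastructure (no Yang–Mills
moduli, `Φ`-invariant, end-periodic manifolds, Casson handles), so the leaf is vendored at the
level of the CONCLUSION of Thm. 4.1. The OUTPUT of steps 1–4 as it enters step 5 — "if there is
a diffeomorphism `d : R⁴_s → R⁴_t`, then `d` restricted to `K` is not the identity" — is
statable with `Opens`/`Diffeomorph` and a compact regular domain `K ⊆ ℝ⁴`
(`IsSmoothCompactDomain`), and step 5's deduction of the leaf from it and from the countability
of embeddings of `K` up to ambient isotopy is PROVED below (`countable_setOf_nonempty_diffeomorph`,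
`deMichelisFreedman1992_countableClasses_of_core`).

## What is proved here, and what remains

* THE LEAF (a hypothesis shape, not a declaration): a monotone family `R : CS → Opens ℝ⁴` of
  open subsets of standard `ℝ⁴` indexed by the standard Cantor set (Mathlib's `cantorSet`), each
  homeomorphic to `ℝ⁴`, such that for every `t` the set of `t'` with `R t'` diffeomorphic to
  `R t` is countable (Thm. 4.1 minus the ribbon/polar-coordinate structure, which has no formal
  counterpart here — the sequel `ExoticOpenFourSpacePolarProofs.lean` renders the polar family;
  its first sentence is the tree fact spc4.S11
  `Literature.Topology.FourManifolds.exists_opens_nonempty_homeomorph_isEmpty_diffeomorph_euclideanSpace_four`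
  and is not re-vendored).
* PROVED: `mk_cantorSet` (`#CS = 𝔠`, from Mathlib's `cantorSetEquivNatToBool`);
  `mk_quotient_eq_of_countable_classes` (an equivalence relation with countable classes on an
  uncountable type has as many classes as elements); `exists_pairwise_of_countable_classes` (choice
  of representatives: a continuum of pairwise inequivalent elements — the content of the printed
  proof of Cor. 4.1); `deMichelisFreedman1992_cor41_of_countableClasses` (Cor. 4.1 AS PRINTED:
  continuum many parameter values with pairwise nondiffeomorphic `R⁴_{t'}`); and
  `deMichelisFreedman1992_continuum_of_countableClasses` (the tree's fact from the leaf).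
* PROVED (step 5, p. 247): `countable_setOf_nonempty_diffeomorph` (the abstract combination: a
  no-go for diffeomorphisms `R t ≅ R t'`, `t ≠ t'`, fixing `K` pointwise, plus a pigeonhole for
  the embeddings `K → R s` obtained from diffeomorphisms `R t ≅ R s`, up to self-diffeomorphisms
  of `R s`, give countable diffeomorphism classes); `deMichelisFreedman1992_countableClasses_of_core`
  and `deMichelisFreedman1992_continuum_of_core` (the leaf, resp. the tree's fact, from the first
  two paragraphs of the printed proof as hypotheses `hcore`, `hgen`); the notion
  `IsSmoothCompactDomain` (compact regular domain = compact regular sublevel set of a smooth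
  function, Lee, Prop. 5.47 and Thm. 5.48) rendering "smooth [compact] codimension zero
  submanifold", with `IsSmoothCompactDomain.isCompact`, `isSmoothCompactDomain_empty`,
  `isSmoothCompactDomain_closedBall`.
* REMAINS: `deMichelisFreedman1992_continuum_holds`, i.e. the leaf (= steps 1–5 above). By
  `deMichelisFreedman1992_continuum_of_core` it reduces exactly to the no-go `hcore` (steps 1–4:
  Kotschick's `Φ`-invariant, Taubes' end-periodic theory, Freedman's structure theorem for
  h-cobordisms) and the general fact `hgen` (discharged in the sequel); no smaller citable
  statement closes the gap, since any family witnessing `deMichelisFreedman1992_continuum`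
  already requires distinguishing uncountably many smooth structures on open subsets of `ℝ⁴`
  (gauge theory).

## References

[DeMichelisFreedman1992] [Kirby1989] [HirschDT1976] [KirbySiebenmann1977] [LeeSmoothManifolds2013]
-/

noncomputable section

open scoped Manifold ContDiff Cardinal
open TopologicalSpace Set

namespace Literature.Barriers.SmoothPoincare4

/-- Local notation: `𝔼 n` is the model Euclidean space `EuclideanSpace ℝ (Fin n)`. -/
local notation "𝔼 " n:arg => EuclideanSpace ℝ (Fin n)

/-! ### Cardinal lemmas: the ZFC argument of the proof of Corollary 4.1 -/

/-- **The standard Cantor set has the cardinality of the continuum**: `#CS = 𝔠`, via Mathlib's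
bijection `cantorSetEquivNatToBool : cantorSet ≃ (ℕ → Bool)` and `2 ^ ℵ₀ = 𝔠`. [folklore] -/
theorem mk_cantorSet : #cantorSet = 𝔠 := by
  rw [Cardinal.mk_congr cantorSetEquivNatToBool, ← Cardinal.power_def, Cardinal.mk_bool,
    Cardinal.mk_nat, Cardinal.two_power_aleph0]

/-- **An equivalence relation with countable classes on an uncountable type has exactly as many
classes as the type has elements** (`#(α/∼) = #α` when every class is countable and `ℵ₀ < #α`):
`≤` always; `≥` because `α` is the union of the classes, so `#α ≤ #(α/∼) · ℵ₀ = #(α/∼)` once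
`#(α/∼)` is infinite, and `#(α/∼) ≤ ℵ₀` would force `#α ≤ ℵ₀` ("the standard diagonal argument"
of the proof of Cor. 4.1). [folklore] -/
theorem mk_quotient_eq_of_countable_classes {α : Type*} (s : Setoid α)
    (hs : ∀ a, {b | s b a}.Countable) (hα : ℵ₀ < #α) : #(Quotient s) = #α := by
  refine le_antisymm Cardinal.mk_quotient_le ?_
  have h1 : #α ≤ #(Quotient s) * ℵ₀ := by
    refine Cardinal.mk_le_mk_mul_of_mk_preimage_le (Quotient.mk s) fun q => ?_
    induction q using Quotient.inductionOn with
    | h a =>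
      rw [Cardinal.le_aleph0_iff_set_countable]
      exact (hs a).mono fun b (hb : Quotient.mk s b = Quotient.mk s a) => Quotient.exact hb
  rcases le_or_gt ℵ₀ #(Quotient s) with h | h
  · rwa [Cardinal.mul_aleph0_eq h] at h1
  · have h2 : #(Quotient s) * ℵ₀ ≤ ℵ₀ := by
      calc #(Quotient s) * ℵ₀ ≤ ℵ₀ * ℵ₀ := mul_le_mul' h.le le_rfl
        _ = ℵ₀ := Cardinal.aleph0_mul_aleph0
    exact absurd (hα.trans_le (h1.trans h2)) (lt_irrefl ℵ₀)

/-- **Choice of representatives (the proof of Cor. 4.1).** If `∼` is an equivalence relation with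
countable classes on a type of cardinality `𝔠`, there is a set of cardinality `𝔠` of pairwise
inequivalent elements: one representative per class (`Quotient.out`, i.e. the axiom of choice —
"In the presence of choice …"), and there are `𝔠` classes by
`mk_quotient_eq_of_countable_classes`. [cite: DeMichelisFreedman1992, Cor. 4.1 and its proof (pp. 247–248)] -/
theorem exists_pairwise_of_countable_classes {α : Type*} (s : Setoid α)
    (hs : ∀ a, {b | s b a}.Countable) (hα : #α = 𝔠) :
    ∃ S : Set α, #S = 𝔠 ∧ ∀ a ∈ S, ∀ b ∈ S, s a b → a = b := by
  refine ⟨Set.range (Quotient.out : Quotient s → α), ?_, ?_⟩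
  · rw [Cardinal.mk_range_eq _ Quotient.out_injective,
      mk_quotient_eq_of_countable_classes s hs (hα ▸ Cardinal.aleph0_lt_continuum), hα]
  · rintro _ ⟨p, rfl⟩ _ ⟨q, rfl⟩ h
    rw [Quotient.out_equiv_out.mp h]

/-! ### Corollary 4.1 from Theorem 4.1, and the tree's fact -/

/-- The relation "`R a` is diffeomorphic to `R b`" on the parameter set of a family of open
subsets of `ℝ⁴` is an equivalence relation ("We say `t` and `t'` are equivalent if `R⁴_t` and
`R⁴_{t'}` are diffeomorphic"), packaged as a `Setoid`. [cite: DeMichelisFreedman1992, Thm. 4.1 (p. 246)] -/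
def diffeomorphSetoid {ι : Type*} (R : ι → Opens (𝔼 4)) : Setoid ι where
  r a b := Nonempty (R a ≃ₘ⟮𝓡 4, 𝓡 4⟯ R b)
  iseqv :=
    { refl := fun a => ⟨Diffeomorph.refl (𝓡 4) (R a) ∞⟩
      symm := fun ⟨e⟩ => ⟨e.symm⟩
      trans := fun ⟨e⟩ ⟨f⟩ => ⟨e.trans f⟩ }

/-- Unfolding lemma for `diffeomorphSetoid`. [folklore] -/
@[simp] theorem diffeomorphSetoid_apply {ι : Type*} (R : ι → Opens (𝔼 4)) (a b : ι) :
    diffeomorphSetoid R a b ↔ Nonempty (R a ≃ₘ⟮𝓡 4, 𝓡 4⟯ R b) :=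
  Iff.rfl

/-- Equal open subsets of `ℝ⁴` are diffeomorphic (transport of `Diffeomorph.refl`). [folklore] -/
theorem nonempty_diffeomorph_of_eq {U V : Opens (𝔼 4)} (h : U = V) :
    Nonempty (U ≃ₘ⟮𝓡 4, 𝓡 4⟯ V) := by
  subst h
  exact ⟨Diffeomorph.refl (𝓡 4) U ∞⟩

/-- **DeMichelis–Freedman 1992, Cor. 4.1 as printed, PROVED from Thm. 4.1** (the leaf — the
`CS`-indexed family of Thm. 4.1 with its countable diffeomorphism classes, see
`deMichelisFreedman1992_continuum_of_countableClasses` — as the hypothesis `h`): "In ZFC we may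
assert that there is a collection of parameter values `{t'} ⊂ CS ⊂ [0, 1]` with `card({t'}) = 𝔠`
such that the subsets `R⁴_{t'}` are pairwise nondiffeomorphic" — here: for the family `R` of the
leaf there is a set `S ⊆ CS` of parameters with `#S = 𝔠` on which "`R a` diffeomorphic to `R b`"
implies `a = b`. The proof is the printed one (countable classes on a set of cardinality `𝔠` give
`𝔠` classes; choose representatives), `exists_pairwise_of_countable_classes` with `mk_cantorSet`.
[cite: DeMichelisFreedman1992, Cor. 4.1 (p. 247), proof p. 248] -/
theorem deMichelisFreedman1992_cor41_of_countableClasses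
    (h : ∃ R : cantorSet → Opens (𝔼 4), Monotone R ∧ (∀ t, Nonempty (R t ≃ₜ 𝔼 4)) ∧
      ∀ t, {t' | Nonempty (R t' ≃ₘ⟮𝓡 4, 𝓡 4⟯ R t)}.Countable) :
    ∃ R : cantorSet → Opens (𝔼 4), (∀ t, Nonempty (R t ≃ₜ 𝔼 4)) ∧
      ∃ S : Set cantorSet, #S = 𝔠 ∧
        ∀ a ∈ S, ∀ b ∈ S, Nonempty (R a ≃ₘ⟮𝓡 4, 𝓡 4⟯ R b) → a = b := by
  obtain ⟨R, -, htop, hcount⟩ := h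
  obtain ⟨S, hS, hpair⟩ :=
    exists_pairwise_of_countable_classes (diffeomorphSetoid R) hcount mk_cantorSet
  exact ⟨R, htop, S, hS, hpair⟩

/-- **The tree's fact from the leaf: Thm. 4.1 implies `deMichelisFreedman1992_continuum`.**
The hypothesis `h` — THE LEAF of this cone, the formal rendering of the family of
DeMichelis–Freedman's Thm. 4.1 — reads: there is a family `R⁴_t`, `t ∈ CS` (the standard Cantor
set in `[0, 1]`, Mathlib's `cantorSet`), of open subsets of standard `ℝ⁴` (each with the smooth
structure induced from `ℝ⁴`: "Any open subset of a Euclidean space acquires a natural smooth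
structure by restriction"), nested (`R⁴_s ⊆ R⁴_t` for `s ≤ t`: the `R⁴_t` are the open balls
`ρ⁻¹([0, r))`, `t = 1 - 1/r`, of a topological radial function `ρ` on `R⁴_1 ⊆ ℝ⁴`; rendered
`Monotone R`, recorded for faithfulness though unused below), each homeomorphic to `ℝ⁴` (an open
ball of a "topological system of polar coordinates"), such that, calling `t` and `t'` equivalent
"if `R⁴_t` and `R⁴_{t'}` are diffeomorphic", "the resulting equivalence classes are at most
countable": for every `t ∈ CS` the set of `t' ∈ CS` with `R⁴_{t'}` diffeomorphic to `R⁴_t` is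
countable. The ribbon structure of the `R⁴_t` ("'ribbon 4-spaces' in the sense of §3") and the
compactum `K ⊂ R⁴_0` are not rendered; the first sentence of Thm. 4.1 (`R⁴_1` is homeomorphic
but not diffeomorphic to `ℝ⁴`) is the tree fact
`Literature.Topology.FourManifolds.exists_opens_nonempty_homeomorph_isEmpty_diffeomorph_euclideanSpace_four`.
Its printed proof rests on Kotschick's `Φ`-invariant, Taubes' end-periodic Yang–Mills theory
(Thm. 2.1) and Freedman's structure theorem for h-cobordisms (Thm. 3.1) — steps 1–5 of the module
docstring, size XL — which is why it is a hypothesis here and why the decomposition child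
`deMichelisFreedman1992_countableClasses` that once named it was merged back (D-0026).
Conclusion: from Cor. 4.1 (`deMichelisFreedman1992_cor41_of_countableClasses`) take the image
`{R⁴_{t'} : t' ∈ S}` of the continuum of pairwise nondiffeomorphic parameters; `t' ↦ R⁴_{t'}` is
injective on `S` (equal sets are diffeomorphic), so the image is a set of open subsets of `ℝ⁴` of
cardinality `𝔠`, each homeomorphic to `ℝ⁴`, on which diffeomorphism implies equality —
literally `deMichelisFreedman1992_continuum`. Hence the discharge
`deMichelisFreedman1992_continuum_holds` reduces exactly to the leaf.
[cite: DeMichelisFreedman1992, Thm. 4.1 (p. 246) and its proof (p. 247); Cor. 4.1 (pp. 247–248)] -/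
theorem deMichelisFreedman1992_continuum_of_countableClasses
    (h : ∃ R : cantorSet → Opens (𝔼 4), Monotone R ∧ (∀ t, Nonempty (R t ≃ₜ 𝔼 4)) ∧
      ∀ t, {t' | Nonempty (R t' ≃ₘ⟮𝓡 4, 𝓡 4⟯ R t)}.Countable) :
    deMichelisFreedman1992_continuum := by
  obtain ⟨R, htop, S, hS, hpair⟩ := deMichelisFreedman1992_cor41_of_countableClasses h
  have hinj : Set.InjOn R S := fun a ha b hb hab =>
    hpair a ha b hb (nonempty_diffeomorph_of_eq hab)
  refine ⟨R '' S, by rw [Cardinal.mk_image_eq_of_injOn _ _ hinj, hS], ?_, ?_⟩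
  · rintro _ ⟨a, -, rfl⟩
    exact htop a
  · rintro _ ⟨a, ha, rfl⟩ _ ⟨b, hb, rfl⟩ hd
    rw [hpair a ha b hb hd]

/-- **The barrier from Thm. 4.1's family**: the leaf (hypothesis `h`, as in
`deMichelisFreedman1992_continuum_of_countableClasses`) already refutes the technique master
statement `OpenSubsetUniquenessFour` ("every open subset of `ℝ⁴` homeomorphic to `ℝ⁴` is
diffeomorphic to `ℝ⁴`"), through `deMichelisFreedman1992_continuum_of_countableClasses` and
`openAnalogueBarrierFour_of_deMichelisFreedman`. [cite: DeMichelisFreedman1992, Thm. 4.1 and Cor. 4.1] -/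
theorem openAnalogueBarrierFour_of_countableClasses
    (h : ∃ R : cantorSet → Opens (𝔼 4), Monotone R ∧ (∀ t, Nonempty (R t ≃ₜ 𝔼 4)) ∧
      ∀ t, {t' | Nonempty (R t' ≃ₘ⟮𝓡 4, 𝓡 4⟯ R t)}.Countable) :
    OpenAnalogueBarrierFour :=
  openAnalogueBarrierFour_of_deMichelisFreedman
    (deMichelisFreedman1992_continuum_of_countableClasses h)

/-! ### Smooth compact domains (the compactum `K` of Theorem 4.1) -/

/-- **Smooth compact domain** (a compact "smooth codimension zero submanifold", i.e. a compact
regular domain, of a real normed space `E`; used for `E = ℝ⁴`): a compact subset `K ⊆ E` which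
is a regular sublevel set `K = {f ≤ 0}` of a smooth function `f : E → ℝ` having `0` as a regular
value (`df(x) ≠ 0` whenever `f x = 0`). Regular sublevel sets are regular domains (properly
embedded codimension-`0` submanifolds with boundary), and every regular domain is the regular
sublevel set of a defining function, so for compact `K` this is exactly "compact codimension-`0`
submanifold with smooth boundary". [cite: LeeSmoothManifolds2013, Ch. 5, Prop. 5.47 and Thm. 5.48 (regular domains, defining functions)] -/
def IsSmoothCompactDomain {E : Type*} [NormedAddCommGroup E] [NormedSpace ℝ E] (K : Set E) :
    Prop :=
  IsCompact K ∧ ∃ f : E → ℝ, ContDiff ℝ ∞ f ∧ K = {x | f x ≤ 0} ∧ ∀ x, f x = 0 → fderiv ℝ f x ≠ 0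

/-- A smooth compact domain is compact. [folklore] -/
theorem IsSmoothCompactDomain.isCompact {E : Type*} [NormedAddCommGroup E] [NormedSpace ℝ E]
    {K : Set E} (h : IsSmoothCompactDomain K) : IsCompact K :=
  h.1

/-- The empty set is a smooth compact domain (`f = 1`). [folklore] -/
theorem isSmoothCompactDomain_empty {E : Type*} [NormedAddCommGroup E] [NormedSpace ℝ E] :
    IsSmoothCompactDomain (∅ : Set E) := by
  refine ⟨isCompact_empty, fun _ => 1, contDiff_const, ?_, fun x hx => absurd hx one_ne_zero⟩
  ext x
  simp

/-- **The closed unit ball is a smooth compact domain** (`f x = ‖x‖² - 1`, whose differential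
`2⟨x, ·⟩` does not vanish on the unit sphere) — Lee's "familiar example" of a regular domain.
[cite: LeeSmoothManifolds2013, Ch. 5 (regular domains: "the closed unit ball")] -/
theorem isSmoothCompactDomain_closedBall {F : Type*} [NormedAddCommGroup F]
    [InnerProductSpace ℝ F] [FiniteDimensional ℝ F] :
    IsSmoothCompactDomain (Metric.closedBall (0 : F) 1) := by
  refine ⟨isCompact_closedBall 0 1, fun x => ‖x‖ ^ 2 - 1,
    (contDiff_norm_sq ℝ).sub contDiff_const, ?_, ?_⟩
  · ext x
    simp only [Metric.mem_closedBall, dist_zero_right, mem_setOf_eq, sub_nonpos]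
    constructor
    · intro h
      nlinarith [norm_nonneg x]
    · intro h
      nlinarith [norm_nonneg x]
  · intro x hx h0
    have hd : HasFDerivAt (fun x : F => ‖x‖ ^ 2 - 1) (2 • innerSL ℝ x) x :=
      (hasStrictFDerivAt_norm_sq x).hasFDerivAt.sub_const 1
    rw [hd.fderiv] at h0
    have h2 : (2 • innerSL ℝ x) x = 0 := by rw [h0]; simp
    have h3 : (2 • innerSL ℝ x) x = 2 * ‖x‖ ^ 2 := by
      simp [two_smul, two_mul]
    have hx1 : ‖x‖ ^ 2 - 1 = 0 := hx
    linarith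

/-! ### Theorem 4.1, third paragraph of the proof: combining the no-go with the countability of embeddings -/

/-- **"Combining the previous two paragraphs"** (proof of Thm. 4.1, p. 247) — the abstract
combination step, PROVED. Let `R` be a family of open subsets of `ℝ⁴` and `K ⊆ ℝ⁴` a set
contained in every `R t`. Suppose (first paragraph) that for `t ≠ t'` no diffeomorphism
`R t → R t'` restricts to the identity on `K` (`hcore`), and (second paragraph, applied to the
embeddings `K → R s` obtained by restricting diffeomorphisms `R t ≅ R s`) that among any
uncountable family of diffeomorphisms `φ_t : R t ≅ R s` there are two, `φ_a`, `φ_b` with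
`a ≠ b`, which differ on `K` by a self-diffeomorphism `h` of `R s`: `h ∘ φ_a = φ_b` on `K`
(`hpig`). Then only countably many `R t` are diffeomorphic to `R s`: otherwise
`φ_b⁻¹ ∘ h ∘ φ_a : R a ≅ R b` is the identity on `K`, contradicting `hcore`.
[cite: DeMichelisFreedman1992, proof of Thm. 4.1, p. 247 ("Combining the previous two paragraphs, we see that the subsets `R⁴_t` could be mutually diffeomorphic for at most countably many parameter values")] -/
theorem countable_setOf_nonempty_diffeomorph {ι : Type*} (R : ι → Opens (𝔼 4)) (K : Set (𝔼 4))
    (hK : ∀ t, K ⊆ R t) (s : ι)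
    (hcore : ∀ t t', t ≠ t' → ∀ d : R t ≃ₘ⟮𝓡 4, 𝓡 4⟯ R t',
      ∃ x : R t, (x : 𝔼 4) ∈ K ∧ ((d x : R t') : 𝔼 4) ≠ x)
    (hpig : ∀ T : Set ι, ¬ T.Countable → ∀ φ : (∀ t : T, R (t : ι) ≃ₘ⟮𝓡 4, 𝓡 4⟯ R s),
      ∃ a b : T, a ≠ b ∧ ∃ h : R s ≃ₘ⟮𝓡 4, 𝓡 4⟯ R s,
        ∀ (x : 𝔼 4) (ha : x ∈ R (a : ι)) (hb : x ∈ R (b : ι)), x ∈ K →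
          ((h (φ a ⟨x, ha⟩) : R s) : 𝔼 4) = (φ b ⟨x, hb⟩ : R s)) :
    {t | Nonempty (R t ≃ₘ⟮𝓡 4, 𝓡 4⟯ R s)}.Countable := by
  by_contra hT
  set T : Set ι := {t | Nonempty (R t ≃ₘ⟮𝓡 4, 𝓡 4⟯ R s)} with hTdef
  let φ : ∀ t : T, R (t : ι) ≃ₘ⟮𝓡 4, 𝓡 4⟯ R s := fun t => Classical.choice t.2
  obtain ⟨a, b, hab, h, hh⟩ := hpig T hT φ
  have hab' : (a : ι) ≠ b := fun e => hab (Subtype.ext e)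
  obtain ⟨x, hxK, hx⟩ := hcore a b hab' ((φ a).trans (h.trans (φ b).symm))
  apply hx
  have hb : (x : 𝔼 4) ∈ R (b : ι) := hK b hxK
  have h1 : h (φ a x) = φ b ⟨x, hb⟩ := Subtype.ext (hh x x.2 hb hxK)
  simp only [Diffeomorph.coe_trans, Function.comp_apply, h1, Diffeomorph.symm_apply_apply]

/-- **DeMichelis–Freedman 1992, Thm. 4.1: the leaf (the hypothesis of
`deMichelisFreedman1992_continuum_of_countableClasses`, here the conclusion) from the two
paragraphs of its printed proof (p. 247), PROVED.**

* `hcore` — the first paragraph (the gauge-theoretic no-go, via Thm. 2.1): the nested family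
  `R⁴_t ⊆ ℝ⁴`, `t ∈ CS`, of open subsets homeomorphic to `ℝ⁴` (Thms. 3.1, 3.2) comes with a
  compactum `K` — "a smooth codimension zero submanifold" (here: a smooth compact domain,
  `IsSmoothCompactDomain K`) with `K ⊂ R⁴_0 ⊆ R⁴_t` (Thm. 3.2) — such that no diffeomorphism
  `R⁴_s → R⁴_t`, `s ≠ t`, restricts to the identity on `K`: "Suppose there is a diffeomorphism
  `(d, id_K) : (R⁴_s, K) → (R⁴_t, K)`, `s ≠ t ∈ CS`. … This leads via Theorem 2.1 to a
  contradiction and the conclusion that if there is a diffeomorphism `d : R⁴_s → R⁴_t`, then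
  `d` restricted to `K` is not the identity".
* `hgen` — the second paragraph, "It is a general fact that a smooth compact manifold admits only
  countably many smooth embeddings, up to isotopy, into any smooth metrizable manifold" ([15] =
  Kirby–Siebenmann for the smooth category), in the ambient form supplied by the isotopy
  extension theorem (Hirsch, Ch. 8, Thm. 1.3; proof of Thm. 1.5: isotopic embeddings `f₀, f₁` of a
  compact `V` in `M ∖ ∂M` satisfy `H₁ f₀ = f₁` for a diffeomorphism `H₁` of `M`): for an open
  `M ⊆ ℝ⁴` and a smooth compact domain `K`, among uncountably many smooth embeddings `K → M`
  which are restrictions of diffeomorphisms `φ_i : U_i ≅ M` of open neighbourhoods `U_i ⊇ K`,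
  two (`i ≠ j`) differ on `K` by a self-diffeomorphism of `M`.
* Conclusion (third paragraph, `countable_setOf_nonempty_diffeomorph`): every diffeomorphism
  class of parameters is countable, i.e. the leaf, and hence
  (`deMichelisFreedman1992_continuum_of_core`) the tree's fact.

`hcore` is not dischargeable today (Kotschick's `Φ`-invariant, Taubes' end-periodic theory,
Freedman's structure theorem); `hgen` is discharged in the sequel
`ExoticOpenFourSpaceEmbeddingProofs.lean` (`exists_ne_diffeomorph_apply_eq_of_not_countable`);
both are hypotheses here, not named facts.
[cite: DeMichelisFreedman1992, Thm. 4.1 and its proof (pp. 246–247); Thm. 3.2 (p. 244)] [cite: HirschDT1976, Ch. 8, Thms. 1.3–1.5 (p. 180)] [cite: KirbySiebenmann1977] -/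
theorem deMichelisFreedman1992_countableClasses_of_core
    (hcore : ∃ (R : cantorSet → Opens (𝔼 4)) (K : Set (𝔼 4)), Monotone R ∧
      (∀ t, Nonempty (R t ≃ₜ 𝔼 4)) ∧ IsSmoothCompactDomain K ∧ (∀ t, K ⊆ R t) ∧
      ∀ s t, s ≠ t → ∀ d : R s ≃ₘ⟮𝓡 4, 𝓡 4⟯ R t,
        ∃ x : R s, (x : 𝔼 4) ∈ K ∧ ((d x : R t) : 𝔼 4) ≠ x)
    (hgen : ∀ (M : Opens (𝔼 4)) (K : Set (𝔼 4)), IsSmoothCompactDomain K →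
      ∀ (ι : Type) (U : ι → Opens (𝔼 4)) (φ : ∀ i, U i ≃ₘ⟮𝓡 4, 𝓡 4⟯ M),
        (∀ i, K ⊆ U i) → ¬ Countable ι →
        ∃ i j, i ≠ j ∧ ∃ h : M ≃ₘ⟮𝓡 4, 𝓡 4⟯ M,
          ∀ (x : 𝔼 4) (hi : x ∈ U i) (hj : x ∈ U j), x ∈ K →
            ((h (φ i ⟨x, hi⟩) : M) : 𝔼 4) = (φ j ⟨x, hj⟩ : M)) :
    ∃ R : cantorSet → Opens (𝔼 4), Monotone R ∧ (∀ t, Nonempty (R t ≃ₜ 𝔼 4)) ∧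
      ∀ t, {t' | Nonempty (R t' ≃ₘ⟮𝓡 4, 𝓡 4⟯ R t)}.Countable := by
  obtain ⟨R, K, hmono, htop, hKdom, hKR, hno⟩ := hcore
  refine ⟨R, hmono, htop, fun s => ?_⟩
  refine countable_setOf_nonempty_diffeomorph R K hKR s hno fun T hT φ => ?_
  have hT' : ¬ Countable T := by rwa [Set.countable_coe_iff]
  obtain ⟨i, j, hij, h, hh⟩ := hgen (R s) K hKdom T (fun t => R (t : cantorSet)) φ
    (fun t => hKR t) hT'
  exact ⟨i, j, hij, h, hh⟩

/-- **The tree's fact from the two paragraphs of the proof of Thm. 4.1**: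
`deMichelisFreedman1992_continuum` (continuum many pairwise non-diffeomorphic open
`ℝ⁴`-homeomorphs in `ℝ⁴`) follows from the no-go `hcore` and the general fact `hgen` of
`deMichelisFreedman1992_countableClasses_of_core`, through the leaf and Cor. 4.1
(`deMichelisFreedman1992_continuum_of_countableClasses`). So the discharge
`deMichelisFreedman1992_continuum_holds` reduces exactly to `hcore` (gauge theory on
end-periodic 4-manifolds and Freedman's h-cobordism structure theorem) and `hgen` (differential
topology of embedding spaces). [cite: DeMichelisFreedman1992, Thm. 4.1, Cor. 4.1 and their proofs (pp. 246–248)] -/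
theorem deMichelisFreedman1992_continuum_of_core
    (hcore : ∃ (R : cantorSet → Opens (𝔼 4)) (K : Set (𝔼 4)), Monotone R ∧
      (∀ t, Nonempty (R t ≃ₜ 𝔼 4)) ∧ IsSmoothCompactDomain K ∧ (∀ t, K ⊆ R t) ∧
      ∀ s t, s ≠ t → ∀ d : R s ≃ₘ⟮𝓡 4, 𝓡 4⟯ R t,
        ∃ x : R s, (x : 𝔼 4) ∈ K ∧ ((d x : R t) : 𝔼 4) ≠ x)
    (hgen : ∀ (M : Opens (𝔼 4)) (K : Set (𝔼 4)), IsSmoothCompactDomain K →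
      ∀ (ι : Type) (U : ι → Opens (𝔼 4)) (φ : ∀ i, U i ≃ₘ⟮𝓡 4, 𝓡 4⟯ M),
        (∀ i, K ⊆ U i) → ¬ Countable ι →
        ∃ i j, i ≠ j ∧ ∃ h : M ≃ₘ⟮𝓡 4, 𝓡 4⟯ M,
          ∀ (x : 𝔼 4) (hi : x ∈ U i) (hj : x ∈ U j), x ∈ K →
            ((h (φ i ⟨x, hi⟩) : M) : 𝔼 4) = (φ j ⟨x, hj⟩ : M)) :
    deMichelisFreedman1992_continuum :=
  deMichelisFreedman1992_continuum_of_countableClasses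
    (deMichelisFreedman1992_countableClasses_of_core hcore hgen)

end Literature.Barriers.SmoothPoincare4

end
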